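import Literature.Probability.RandomPlanarGeometry.SelfAvoidingWalk
import Literature.Probability.LatticeModels.MedialInterface
import Literature.Probability.LatticeModels.PolylineWinding
import Mathlib.Analysis.Normed.Module.FiniteDimension
import HarnessLib

/-!
# The SAW parafermionic observable on the square lattice `δℤ²`

Topic `Literature/Probability/RandomPlanarGeometry`; definition request
`defn-SAWParafermionicObservable` (route `CriticalPhenomena/SAWScalingLimit/SAWParafermion`,
item `stmt-CriticalPhenomena-0790`): the transposition to `δℤ²` of Duminil-Copin–Smirnov's
parafermionic observable (Ann. of Math. 175 (2012), arXiv:1007.0575, §2, Definition 1, printed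
for the hexagonal lattice at mid-edges — the hexagonal original is
`Literature.Probability.RandomPlanarGeometry.SAW.hexParafermionicObservable`, file `HexParafermion.lean`; Smirnov, ICM 2006, §5):
"`F(z) = F(a, z, x, σ) = Σ_{γ ⊂ Ω : a → z} e^{-iσ W_γ(a,z)} x^{ℓ(γ)}`", `W_γ(a, z)` "the total
rotation of the direction in radians when `γ` is traversed from `a` to" `z`.

Here `Ω_δ = discreteDomainGraph Ω δ ⊆ δℤ²`, walks are the library's `Literature.SAW.DomainSAW Ω δ a z`
(self-avoiding walks of `Ω_δ` from the root vertex `a` to the vertex `z`), the weight is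
`x^{|γ|}` with `|γ| = DomainSAW.length` (number of steps, the convention of `Literature.Probability.RandomPlanarGeometry.SAW.weight`), and
the winding is `Literature.Probability.LatticeModels.winding` of the mesh polyline `γ.walk.support.map (meshPoint δ)`
(each turn on `ℤ²` is `0` or `±π/2`).

## Contents (namespace `Literature.SAW`)

* `DomainSAW.winding γ = W_γ(a, z)`, `DomainSAW.parafermionicWeight γ x σ = e^{-iσW_γ} x^{|γ|}`.
* **`parafermionicObservable Ω δ a x σ z = F(a, z; x, σ)`** (VERTEX version): the `tsum` over
  `DomainSAW Ω δ a z` (a finite sum for bounded `Ω`, `δ > 0`; junk `0` if not summable).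
* `midEdgeParafermionicObservable Ω δ a x σ e` (MID-EDGE version, as in DCS): for an edge
  `e = {z, w}` of `Ω_δ`, the sum over both endpoints `z' ∈ e` and over SAWs `γ : a → z'` not having
  used the edge `e`, of `e^{-iσ W} x^{|γ| + 1}`, `W` the winding of the polyline continued to the
  midpoint `medialPoint δ e` (the walk covers the half-edge from `z'` to the middle of `e`;
  `|γ| + 1` = number of vertices visited, DCS's `ℓ(γ)`).
* `criticalParafermionicObservable` — the critical case `x = criticalFugacity` (`= 1/μ(ℤ²)`),
  `σ = 5/8`.
* API: `parafermionicObservable_self` (`F(a, a) = 1`: a closed self-avoiding walk is trivial),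
  `norm_parafermionicWeight`, `norm_parafermionicObservable_le` (`|F(z)| ≤ Σ_γ x^{|γ|}` for
  `x ≥ 0`, unconditionally: in `ℂ` summability is absolute).

## Design choices

* `tsum` rather than a `Finset` sum: `DomainSAW Ω δ a z` carries no `Fintype` instance in
  general (`Ω` may be unbounded); for bounded `Ω` the type is finite and `tsum_fintype` converts.
* Junk regimes: `x < 0` is allowed in the definition (lemmas assume `0 ≤ x`); for `a` or `z`
  outside `Ω_δ` and `a ≠ z` there is no walk and `F = 0`; `F(a, a) = 1` for every `a` (also
  isolated ones), as the trivial walk is always a SAW — matching DCS's `F(a) = 1`.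
* The mid-edge version forbids re-use of `e` (`s(z', w') ∉ γ.walk.edges`), exactly DCS's
  edge-self-avoidance for walks ending on a half-edge (cf. `HexMidEdgeSAW.edges_nodup`); the
  far endpoint of `e` may have been visited earlier (DCS's walks "visiting all three mid-edges").
-/

noncomputable section

open Literature.Probability.LatticeModels Literature.Probability.Percolation Complex

namespace Literature.Probability.RandomPlanarGeometry.SAW

namespace DomainSAW

variable {Ω : Set ℂ} {δ : ℝ} {a z : Site 2}

/-- **The winding `W_γ(a, z)`** of a SAW of `Ω_δ ⊆ δℤ²`: the total signed turning (radians) of the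
mesh polyline `δa = δω₀, δω₁, …, δωₙ = δz` (`Literature.Probability.LatticeModels.winding`; each turn is `0` or `±π/2`).
[cite: DuminilCopinSmirnov2012, §2 (winding)] -/
def winding (γ : DomainSAW Ω δ a z) : ℝ :=
  Literature.Probability.LatticeModels.winding (γ.walk.support.map (meshPoint δ))

/-- The parafermionic weight `e^{-iσ W_γ(a,z)} x^{|γ|}` of a SAW. [cite: DuminilCopinSmirnov2012, Def. 1] -/
def parafermionicWeight (γ : DomainSAW Ω δ a z) (x σ : ℝ) : ℂ :=
  Complex.exp (-Complex.I * σ * (γ.winding : ℝ)) * (x : ℂ) ^ γ.length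

/-- The trivial walk has winding `0`. [folklore] -/
@[simp] theorem winding_nil (a : Site 2) : (nil a : DomainSAW Ω δ a a).winding = 0 := by
  simp [winding, nil]

/-- The trivial walk has weight `1`. [folklore] -/
@[simp] theorem parafermionicWeight_nil (a : Site 2) (x σ : ℝ) :
    (nil a : DomainSAW Ω δ a a).parafermionicWeight x σ = 1 := by
  simp [parafermionicWeight]

/-- The norm of the weight is `x^{|γ|}` for `x ≥ 0` (the winding factor is unimodular). [folklore] -/
theorem norm_parafermionicWeight (γ : DomainSAW Ω δ a z) {x : ℝ} (hx : 0 ≤ x) (σ : ℝ) :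
    ‖γ.parafermionicWeight x σ‖ = x ^ γ.length := by
  rw [parafermionicWeight, norm_mul, Complex.norm_exp, norm_pow, Complex.norm_real,
    Real.norm_of_nonneg hx]
  simp

/-- A self-avoiding walk from `a` to `a` is the trivial walk. [folklore] -/
theorem eq_nil_of_self (γ : DomainSAW Ω δ a a) : γ = nil a := by
  obtain ⟨w, hw⟩ := γ
  obtain rfl := SimpleGraph.Walk.eq_nil_iff_nil.2 (SimpleGraph.Walk.isPath_iff_nil.1 hw)
  rfl

/-- The SAWs from `a` to `a` form a one-element type. [folklore] -/
instance uniqueSelf : Unique (DomainSAW Ω δ a a) := ⟨⟨nil a⟩, eq_nil_of_self⟩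

end DomainSAW

/-! ### The observable -/

/-- **The SAW parafermionic observable on `δℤ²` (vertex version)**: for the discrete domain
`Ω_δ = discreteDomainGraph Ω δ`, a root vertex `a`, fugacity `x`, spin `σ` and a vertex `z`,
`F(a, z; x, σ) = Σ_{γ ⊂ Ω_δ : a → z SAW} e^{-iσ W_γ(a,z)} x^{|γ|}` (as a `tsum`; DCS Definition 1
transposed from hexagonal mid-edges to square-lattice vertices).
[cite: DuminilCopinSmirnov2012, Def. 1] -/
def parafermionicObservable (Ω : Set ℂ) (δ : ℝ) (a : Site 2) (x σ : ℝ) (z : Site 2) : ℂ :=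
  ∑' γ : DomainSAW Ω δ a z, γ.parafermionicWeight x σ

/-- The contribution to the mid-edge observable of the walks reaching the edge `{z, w}` from the
`z` side: SAWs `γ : a → z` of `Ω_δ` which have not used the edge `{z, w}`, continued by the
half-edge from `δz` to the midpoint `medialPoint δ {z, w}`; weight `e^{-iσW} x^{|γ|+1}` with `W`
the winding of the continued polyline and `|γ| + 1` the number of vertices visited.
[cite: DuminilCopinSmirnov2012, Def. 1] -/
def halfEdgeTerm (Ω : Set ℂ) (δ : ℝ) (a : Site 2) (x σ : ℝ) (z w : Site 2) : ℂ :=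
  ∑' γ : DomainSAW Ω δ a z,
    if s(z, w) ∈ γ.walk.edges then 0 else
      Complex.exp (-Complex.I * σ *
          (Literature.Probability.LatticeModels.winding (γ.walk.support.map (meshPoint δ) ++ [medialPoint δ s(z, w)]) : ℝ)) *
        (x : ℂ) ^ (γ.length + 1)

/-- **The SAW parafermionic observable on `δℤ²` (mid-edge version, as printed by DCS)** at the
edge `e = {z, w}`: the sum of the two half-edge terms (walks arriving at the middle of `e` from
either endpoint); intended for edges `e` of `Ω_δ`. [cite: DuminilCopinSmirnov2012, Def. 1] -/
def midEdgeParafermionicObservable (Ω : Set ℂ) (δ : ℝ) (a : Site 2) (x σ : ℝ) :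
    Sym2 (Site 2) → ℂ :=
  Sym2.lift ⟨fun z w => halfEdgeTerm Ω δ a x σ z w + halfEdgeTerm Ω δ a x σ w z,
    fun _ _ => add_comm _ _⟩

/-- `midEdgeParafermionicObservable` on an explicit edge. [folklore] -/
@[simp] theorem midEdgeParafermionicObservable_mk (Ω : Set ℂ) (δ : ℝ) (a : Site 2) (x σ : ℝ)
    (z w : Site 2) :
    midEdgeParafermionicObservable Ω δ a x σ s(z, w) =
      halfEdgeTerm Ω δ a x σ z w + halfEdgeTerm Ω δ a x σ w z := rfl

/-- The **critical** SAW parafermionic observable on `δℤ²`: fugacity `x = x_c = 1/μ(ℤ²)`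
(`criticalFugacity`) and spin `σ = 5/8` (DCS Lemma 1's values, transposed).
[cite: DuminilCopinSmirnov2012, Lemma 1] -/
def criticalParafermionicObservable (Ω : Set ℂ) (δ : ℝ) (a z : Site 2) : ℂ :=
  parafermionicObservable Ω δ a criticalFugacity (5 / 8) z

/-! ### API -/

/-- Unfolding the observable. [cite: DuminilCopinSmirnov2012, Def. 1] -/
theorem parafermionicObservable_def (Ω : Set ℂ) (δ : ℝ) (a : Site 2) (x σ : ℝ) (z : Site 2) :
    parafermionicObservable Ω δ a x σ z = ∑' γ : DomainSAW Ω δ a z, γ.parafermionicWeight x σ :=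
  rfl

/-- **`F(a, a) = 1`**: the only self-avoiding walk from `a` to `a` is the trivial one (length `0`,
winding `0`). [cite: DuminilCopinSmirnov2012, §3 proof of Lemma 2 ("F(a) = 1")] -/
theorem parafermionicObservable_self (Ω : Set ℂ) (δ : ℝ) (a : Site 2) (x σ : ℝ) :
    parafermionicObservable Ω δ a x σ a = 1 := by
  rw [parafermionicObservable, tsum_fintype, Fintype.sum_unique]
  exact DomainSAW.parafermionicWeight_nil a x σ

/-- **`|F(a, z)| ≤ Σ_γ x^{|γ|}`** for `x ≥ 0` (triangle inequality; unimodular winding factors).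
Unconditional: in `ℂ` summability is absolute (`summable_norm_iff`), and if the weights are not
summable the left side is the junk value `0` while the right side is `≥ 0`. [folklore] -/
theorem norm_parafermionicObservable_le (Ω : Set ℂ) (δ : ℝ) (a : Site 2) {x : ℝ} (hx : 0 ≤ x)
    (σ : ℝ) (z : Site 2) :
    ‖parafermionicObservable Ω δ a x σ z‖ ≤ ∑' γ : DomainSAW Ω δ a z, x ^ γ.length := by
  have hnorm : (fun γ : DomainSAW Ω δ a z => ‖γ.parafermionicWeight x σ‖) =
      fun γ => x ^ γ.length := funext fun γ => γ.norm_parafermionicWeight hx σ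
  by_cases hs : Summable fun γ : DomainSAW Ω δ a z => γ.parafermionicWeight x σ
  · have hs' : Summable fun γ : DomainSAW Ω δ a z => ‖γ.parafermionicWeight x σ‖ :=
      summable_norm_iff.2 hs
    calc ‖parafermionicObservable Ω δ a x σ z‖
        ≤ ∑' γ : DomainSAW Ω δ a z, ‖γ.parafermionicWeight x σ‖ := norm_tsum_le_tsum_norm hs'
      _ = ∑' γ : DomainSAW Ω δ a z, x ^ γ.length := by rw [hnorm]
  · rw [parafermionicObservable, tsum_eq_zero_of_not_summable hs, norm_zero]
    exact tsum_nonneg fun γ => pow_nonneg hx _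

/-- At spin `σ = 0` the observable is the two-point generating function `Σ_γ x^{|γ|}`.
[folklore] -/
theorem parafermionicObservable_zero_spin (Ω : Set ℂ) (δ : ℝ) (a : Site 2) (x : ℝ) (z : Site 2) :
    parafermionicObservable Ω δ a x 0 z =
      ((∑' γ : DomainSAW Ω δ a z, x ^ γ.length : ℝ) : ℂ) := by
  rw [parafermionicObservable, Complex.ofReal_tsum]
  refine tsum_congr fun γ => ?_
  simp [DomainSAW.parafermionicWeight]

end Literature.Probability.RandomPlanarGeometry.SAW
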